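import Summits.BirchSwinnertonDyer.BirchSwinnertonDyer.Theorems.AlignedTransportAtTwoMainConjectureTransportAlignedAtTwoOrdPlusLineWitnessMinus
import HarnessLib

/-!
# Crux C1 `MainConjectureTransportAlignedAtTwo` (stmt-BirchSwinnertonDyer-22296), line `birth`, the `Δ > 0` half (R1) of the promoted residual:
# THE `λ`-LAW OFF THE KILFORD STRATUM FROM ONE ANTI-INVARIANT ODD MINUS WITNESS AT ONE ADMISSIBLE LEVEL — NO SIGN CONDITION ON `Δ`
# (width seat att-p4 g12; `--supports 22296`)

THEOREMS ONLY (no `def`, no `sorry`). CONDITIONAL on the two named Literature facts `heckeSelfDual_torsionBy_J0`, `buzzard2000_multiplicityOne_gamma0`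
(hypotheses) AND on ONE explicit parity witness at the chosen level (hypothesis `hII`). BSD is not proved by this; C1 is not closed by this; the
residual stub `stub_lamLawResidual` is NOT discharged by this.

`lamLaw_of_not_padicSquare_of_antiInvariant_witness`: `…OrdPlusLineWitnessLaw.lamLaw_of_not_padicSquare_of_real_witnesses` WITHOUT the invariant plus
witness (I) — it is redundant: the selection `…OrdPlusLineWitnessMinus.periodFunctionals_congr_mod_two_of_real_antiInvariant_witness` needs, besides
the anti-invariant witness (II) `γ ∈ Γ₀(N')`, `{∞,(εγε)∞} = −{∞,γ∞}`, `(2D/Ω⁻(f₁))·im{∞,γ∞}_{g₁}` odd, only an odd value of `n₂` somewhere on `Λ`,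
which is the tree's `μ = 0` theorem for `W₂` (`…OrdPlusLineOdd.exists_odd_depleted_periodFunctional`). Admissible level data as parameters (`q₀`,
`SS = primes(q₀N₁N₂)∖{2}`, `N' = q₀N₁N₂∏ℓ²`, the `SS`-depleted forms `g₁ g₂` pinned by their `q`-expansions); steps §4–§8 are the lead's
`…OrdPlusLine` verbatim in substance. `lamLaw_of_not_padicSquare_of_matrix_witness`: (II) := `γ = (a b; c a) ∈ Γ₀(N')` with the odd minus value.
Either curve of the pair may play `W₁` (the conclusion is symmetric); see `Cruxes/…/DELTA-POS-WITNESS-att-p4-g12.md` for when NO choice can work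
(`X₀(N₁)(ℝ)` connected, i.e. prime-power conductor, on both sides) and for the other honest limits of the witness route.

References: Mazur–Tate–Teitelbaum 1986 §I.10; Greenberg–Vatsal 2000 Thm. (1.4), §3 Rem. 3.4; Emerton–Pollack–Weston 2006 §3–4; Buzzard 2000 Prop. 2.4;
Darmon–Diamond–Taylor 1995 §1.6, §4.5; Matsuno 2008 §5; Snowden 2011 Prop. 1.2.1.
-/
noncomputable section

-- justification: the `Summit.BirchSwinnertonDyer.BirchSwinnertonDyer.…` path repeats a component (route-file convention)
set_option linter.dupNamespace false
set_option autoImplicit false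

open scoped MatrixGroups ModularForm NumberField Classical
open CongruenceSubgroup Complex WeierstrassCurve IsDedekindDomain PowerSeries Polynomial Module
open Literature.NumberTheory.EllipticCurves Literature.NumberTheory.EllipticCurves.ModularForms
open Literature.NumberTheory.EllipticCurves.Greenberg1999 Literature.NumberTheory.EllipticCurves.GreenbergVatsal2000
open Summit.BirchSwinnertonDyer.Rank1Residual.F1Sign2 Summit.BirchSwinnertonDyer.Rank1Residual.X1.MuLambda
open Summit.BirchSwinnertonDyer.BirchSwinnertonDyer.Theorems.AlignedTransportAtTwoSigmaGlue
open Summit.BirchSwinnertonDyer.BirchSwinnertonDyer.Theorems.AlignedTransportAtTwoClosure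
open Summit.BirchSwinnertonDyer.BirchSwinnertonDyer.Theorems.AlignedTransportAtTwoSigmaRaw
open Summit.BirchSwinnertonDyer.BirchSwinnertonDyer.Theorems.AlignedTransportAtTwoSigmaSymbolParity
open Summit.BirchSwinnertonDyer.BirchSwinnertonDyer.Theorems.SignedTransportAtTwo
open Summit.BirchSwinnertonDyer.BirchSwinnertonDyer.Theorems.ThetaLayerLambdaCongruenceAtTwo
open Summit.BirchSwinnertonDyer.BirchSwinnertonDyer.Theorems.AlignedTransportAtTwoDepletedPeriodFormula
open Summit.BirchSwinnertonDyer.BirchSwinnertonDyer.Theorems.AlignedTransportAtTwoOrdPlusLineTools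
open Summit.BirchSwinnertonDyer.BirchSwinnertonDyer.Theorems.AlignedTransportAtTwoOrdPlusLineWitness
open Summit.BirchSwinnertonDyer.BirchSwinnertonDyer.Theorems.AlignedTransportAtTwoOrdPlusLineWitnessMinus
open Summit.BirchSwinnertonDyer.BirchSwinnertonDyer.Theorems.AlignedTransportAtTwoOrdPlusLineWitnessClasses
open Summit.BirchSwinnertonDyer.BirchSwinnertonDyer.Theorems.AlignedTransportAtTwoOrdPlusLineOdd
open Summit.BirchSwinnertonDyer.BirchSwinnertonDyer.Theorems.AlignedTransportAtTwoOrdPlusLineCusp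
open Summit.BirchSwinnertonDyer.BirchSwinnertonDyer.Theorems.AlignedTransportAtTwoSharedCubicTorsion

namespace Summit.BirchSwinnertonDyer.BirchSwinnertonDyer.Theorems.AlignedTransportAtTwoOrdPlusLineWitnessMinusLaw

/-- **The `λ`-law off the Kilford stratum from ONE anti-invariant odd minus witness at one admissible level, NO sign condition on `Δ(W₁)`.**
Two globally minimal curves, good ordinary at `2`, no rational `2`-torsion abscissa, sharing a cubic field, `Δ(W₁) ∉ ℚ₂²`; newforms `f₁ f₂`,
even-branch lifts `G₁ G₂`; admissible level data `q₀`, `SS`, `N'`, the `SS`-depleted forms `g₁ g₂`; PRINT inputs `hSD`, `hBz`; witness (II):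
`γ ∈ Γ₀(N')` with `ι`-anti-invariant class and `(2D/Ω⁻(f₁))·im{∞,γ∞}_{g₁}` odd. Conclusion: `λ(G₁) + Σ_{ℓ ∣ N₁N₂ odd} e_ℓ(W₁) = λ(G₂) + Σ e_ℓ(W₂)`.
[cite: GreenbergVatsal2000, Thm. (1.4) and §3 Remark 3.4] [cite: EmertonPollackWeston2006, Thm. 3.6.2 and Cor. 4.3.3]
[cite: Buzzard2000LevelLoweringModTwo, Prop. 2.4] [cite: DarmonDiamondTaylor1995, §1.6 Lemma 1.38, §4.5 Thm. 4.26] [cite: MazurTateTeitelbaum1986Invent, §I.10] -/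
theorem lamLaw_of_not_padicSquare_of_antiInvariant_witness
    (hSD : heckeSelfDual_torsionBy_J0) (hBz : buzzard2000_multiplicityOne_gamma0)
    (W₁ : WeierstrassCurve ℚ) [W₁.IsElliptic] [W₁.IsGloballyMinimal]
    (W₂ : WeierstrassCurve ℚ) [W₂.IsElliptic] [W₂.IsGloballyMinimal]
    (hord₁ : IsOrdinaryAt W₁ 2) (hord₂ : IsOrdinaryAt W₂ 2)
    (ht₁ : ∀ x : ℚ, ¬ HasRationalTwoTorsionX W₁ x) (ht₂ : ∀ x : ℚ, ¬ HasRationalTwoTorsionX W₂ x)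
    (hΔ₂ : ∀ s : ℚ_[2], s ^ 2 ≠ (W₁.Δ : ℚ_[2]))
    {F : Type} [Field F] [NumberField F] (hF : finrank ℚ F = 3)
    {e₁ e₂ : F} (he₁ : aeval e₁ (twoDivisionUCubic W₁) = 0) (he₂ : aeval e₂ (twoDivisionUCubic W₂) = 0)
    [NeZero (W₁.conductorNorm ℤ)] [NeZero (W₂.conductorNorm ℤ)]
    {f₁ : CuspForm (Gamma0 (W₁.conductorNorm ℤ)) 2} (hf₁ : IsNewformOf W₁ f₁)
    {f₂ : CuspForm (Gamma0 (W₂.conductorNorm ℤ)) 2} (hf₂ : IsNewformOf W₂ f₂)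
    {G₁ G₂ : IwasawaAlgebra 2} (hG₁ : IsEvenBranchLiftAtTwo W₁ f₁ G₁) (hG₂ : IsEvenBranchLiftAtTwo W₂ f₂ G₂)
    -- admissible level data
    {q₀ : ℕ} (hq₀ : q₀.Prime) (hq₀2 : q₀ ≠ 2) (hq₀N : ¬ q₀ ∣ W₁.conductorNorm ℤ * W₂.conductorNorm ℤ)
    (SS : Finset ℕ) (hSS : SS = (q₀ * (W₁.conductorNorm ℤ * W₂.conductorNorm ℤ)).primeFactors.erase 2)
    (N' : ℕ) [NeZero N'] (hN' : N' = q₀ * (W₁.conductorNorm ℤ * W₂.conductorNorm ℤ) * ∏ ℓ ∈ SS, ℓ ^ 2)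
    (g₁ g₂ : CuspForm (Gamma0 N') 2)
    (hg₁ : ∀ n : ℕ, cuspCoeff g₁ n = if ∃ ℓ ∈ SS, ℓ ∣ n then 0 else cuspCoeff f₁ n)
    (hg₂ : ∀ n : ℕ, cuspCoeff g₂ n = if ∃ ℓ ∈ SS, ℓ ∣ n then 0 else cuspCoeff f₂ n)
    -- the anti-invariant odd minus witness at level `N'`
    (hII : ∃ γ : Gamma0 N', periodFunctional N' ⟨iotaConj (γ : SL(2, ℤ)), iotaConj_coe_mem_gamma0 γ⟩ = -periodFunctional N' γ ∧
      ∃ w : ℤ, (2 * ((∏ ℓ ∈ SS, ℓ ^ 2 : ℕ) : ℝ) / minusPeriod f₁) * (cuspSymbol g₁ γ).im = w ∧ Odd w) :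
    lam G₁ + ∑ ℓ ∈ (W₁.conductorNorm ℤ * W₂.conductorNorm ℤ).primeFactors.erase 2, lambdaCorrectionAtTwo W₁ ℓ =
      lam G₂ + ∑ ℓ ∈ (W₁.conductorNorm ℤ * W₂.conductorNorm ℤ).primeFactors.erase 2, lambdaCorrectionAtTwo W₂ ℓ := by
  -- §0 the two odd conductors
  have hN₁0 : W₁.conductorNorm ℤ ≠ 0 := NeZero.ne _
  have hN₂0 : W₂.conductorNorm ℤ ≠ 0 := NeZero.ne _
  have h2N₁ : ¬ 2 ∣ W₁.conductorNorm ℤ := not_dvd_level_of_isNewformOf hf₁ hord₁.1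
  have h2N₂ : ¬ 2 ∣ W₂.conductorNorm ℤ := not_dvd_level_of_isNewformOf hf₂ hord₂.1
  have hirr₁ := irr_two_of_forall_not_hasRationalTwoTorsionX W₁ ht₁
  have hred₁ : red G₁ ≠ 0 :=
    Summit.BirchSwinnertonDyer.BirchSwinnertonDyer.Theorems.AnalyticMuTwo.red_ne_zero_of_isEvenBranchLiftAtTwo_of_forall_not_hasRationalTwoTorsionX
      W₁ hord₁ ht₁ f₁ hf₁ G₁ hG₁
  -- §1 the auxiliary odd good prime `q₀ ∤ N₁N₂`
  have hq₀N₁ : ¬ q₀ ∣ W₁.conductorNorm ℤ := fun h ↦ hq₀N (dvd_mul_of_dvd_left h _)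
  have hq₀N₂ : ¬ q₀ ∣ W₂.conductorNorm ℤ := fun h ↦ hq₀N (dvd_mul_of_dvd_right h _)
  set M : ℕ := q₀ * (W₁.conductorNorm ℤ * W₂.conductorNorm ℤ) with hM
  have hM0 : M ≠ 0 := mul_ne_zero hq₀.ne_zero (mul_ne_zero hN₁0 hN₂0)
  have h2M : ¬ 2 ∣ M := by
    intro h
    rcases (Nat.Prime.dvd_mul Nat.prime_two).mp h with h | h
    · exact hq₀2 ((Nat.prime_dvd_prime_iff_eq Nat.prime_two hq₀).mp h).symm
    · rcases (Nat.Prime.dvd_mul Nat.prime_two).mp h with h | h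
      · exact h2N₁ h
      · exact h2N₂ h
  -- §2 the depletion set `S` (odd places of `M`) realising `SS`, `D = ∏ ℓ²`, the level `N' = M·D`
  obtain ⟨S, hS2, himg⟩ := exists_oddPlaces M
  set l := S.toList with hl
  have hlnd : l.Nodup := S.nodup_toList
  have hl2 : ∀ v ∈ l, Rat.HeightOneSpectrum.natGenerator v ≠ 2 := fun v hv ↦ hS2 v (Finset.mem_toList.mp hv)
  have hSSl : SS = (l.map Rat.HeightOneSpectrum.natGenerator).toFinset := by
    rw [hSS, ← himg]; ext ℓ
    simp only [hl, List.mem_toFinset, List.mem_map, Finset.mem_toList, Finset.mem_image]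
  subst hSSl
  set SS : Finset ℕ := (l.map Rat.HeightOneSpectrum.natGenerator).toFinset with hSSdef
  have hSSeq : SS = M.primeFactors.erase 2 := hSS
  have hSSp : ∀ ℓ ∈ SS, ℓ.Prime := fun ℓ hℓ ↦
    Nat.prime_of_mem_primeFactors (Finset.mem_of_mem_erase (hSSeq ▸ hℓ))
  have hSS2' : ∀ ℓ ∈ SS, ℓ ≠ 2 := fun ℓ hℓ ↦ Finset.ne_of_mem_erase (hSSeq ▸ hℓ)
  have hSSdvd : ∀ ℓ ∈ SS, ℓ ∣ M := fun ℓ hℓ ↦ Nat.dvd_of_mem_primeFactors (Finset.mem_of_mem_erase (hSSeq ▸ hℓ))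
  set D : ℕ := ∏ ℓ ∈ SS, ℓ ^ 2 with hD
  have hD0 : D ≠ 0 := Finset.prod_ne_zero_iff.mpr fun ℓ hℓ ↦ pow_ne_zero _ (hSSp ℓ hℓ).ne_zero
  have h2D : ¬ 2 ∣ D := by
    intro h
    obtain ⟨ℓ, hℓ, hℓ2⟩ := (Nat.prime_two.prime.dvd_finsetProd_iff _).mp h
    exact hSS2' ℓ hℓ ((Nat.prime_dvd_prime_iff_eq Nat.prime_two (hSSp ℓ hℓ)).mp (Nat.prime_two.dvd_of_dvd_pow hℓ2)).symm
  have hDnorm : ‖((D : ℕ) : ℚ_[2])‖ = 1 := norm_prod_sq_eq_one SS hSSp hSS2'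
  have hN'MD : N' = M * D := hN'
  have h2N' : ¬ 2 ∣ N' := fun h ↦ ((Nat.Prime.dvd_mul Nat.prime_two).mp (hN'MD ▸ h)).elim h2M h2D
  have hN'odd : Odd N' := Nat.odd_iff.mpr (Nat.two_dvd_ne_zero.mp h2N')
  have hNL₁ : W₁.conductorNorm ℤ * D ∣ N' := ⟨q₀ * W₂.conductorNorm ℤ, by rw [hN'MD, hM]; ring⟩
  have hNL₂ : W₂.conductorNorm ℤ * D ∣ N' := ⟨q₀ * W₁.conductorNorm ℤ, by rw [hN'MD, hM]; ring⟩
  have hN₁N' : W₁.conductorNorm ℤ ∣ N' := (dvd_mul_right _ D).trans hNL₁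
  have hN₂N' : W₂.conductorNorm ℤ ∣ N' := (dvd_mul_right _ D).trans hNL₂
  have hSSN' : ∀ ℓ ∈ SS, ℓ ∣ N' := fun ℓ hℓ ↦ (hSSdvd ℓ hℓ).trans (hN'MD ▸ dvd_mul_right M D)
  have hLS : ∀ p : ℕ, p.Prime → p ∣ N' → p ∈ SS := by
    intro p hp hpN
    rw [hN'MD] at hpN
    rcases (Nat.Prime.dvd_mul hp).mp hpN with h | h
    · rw [hSSeq]
      refine Finset.mem_erase.mpr ⟨?_, Nat.mem_primeFactors.mpr ⟨hp, h, hM0⟩⟩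
      rintro rfl; exact h2M h
    · obtain ⟨ℓ, hℓ, hℓp⟩ := (hp.prime.dvd_finsetProd_iff _).mp h
      rwa [(Nat.prime_dvd_prime_iff_eq hp (hSSp ℓ hℓ)).mp (hp.dvd_of_dvd_pow hℓp)]
  have hgood₁ : ∀ v : HeightOneSpectrum (𝓞 ℚ), ¬ ((Rat.HeightOneSpectrum.primesEquiv v : ℕ) ∣ 2 * N') →
      W₁.HasGoodReductionAt v := by
    intro v hv
    by_contra hbad
    exact hv (dvd_mul_of_dvd_right (((WeierstrassCurve.dvd_conductorNorm_iff (W := W₁) v).mpr hbad).trans hN₁N') 2)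
  -- §3 the two depleted eigenforms at level `N'` ARE the given `g₁, g₂` (uniqueness of `q`-expansions)
  have hint₁ : ∀ n : ℕ, ∃ z : ℤ, cuspCoeff f₁ n = z := fun n ↦ ⟨W₁.LFunction n, hf₁.2 n⟩
  have hint₂ : ∀ n : ℕ, ∃ z : ℤ, cuspCoeff f₂ n = z := fun n ↦ ⟨W₂.LFunction n, hf₂.2 n⟩
  have hTf₁ : ∀ (p : ℕ) (hp : p.Prime),
      (haveI : NeZero p := ⟨hp.ne_zero⟩; heckeT (Gamma0 (W₁.conductorNorm ℤ)) 2 p f₁) = cuspCoeff f₁ p • f₁ :=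
    fun p hp ↦ by haveI : NeZero p := ⟨hp.ne_zero⟩; exact hf₁.1.heckeT_eq_coeff_smul hp
  have hTf₂ : ∀ (p : ℕ) (hp : p.Prime),
      (haveI : NeZero p := ⟨hp.ne_zero⟩; heckeT (Gamma0 (W₂.conductorNorm ℤ)) 2 p f₂) = cuspCoeff f₂ p • f₂ :=
    fun p hp ↦ by haveI : NeZero p := ⟨hp.ne_zero⟩; exact hf₂.1.heckeT_eq_coeff_smul hp
  obtain ⟨g₁', hg₁'', -, hgr₁, -, hgT₁, hgU₁, -⟩ := exists_depleted_eigenform_of_dvd f₁ hint₁ hf₁.1.2.2 hTf₁ SS hSSp N' hNL₁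
    (fun p hp hpN ↦ Or.inr (hLS p hp hpN))
  obtain ⟨g₂', hg₂'', -, hgr₂, -, hgT₂, hgU₂, -⟩ := exists_depleted_eigenform_of_dvd f₂ hint₂ hf₂.1.2.2 hTf₂ SS hSSp N' hNL₂
    (fun p hp hpN ↦ Or.inr (hLS p hp hpN))
  obtain rfl : g₁ = g₁' := eq_of_forall_cuspCoeff_eq_gamma0 fun n ↦ by rw [hg₁ n, hg₁'' n]
  obtain rfl : g₂ = g₂' := eq_of_forall_cuspCoeff_eq_gamma0 fun n ↦ by rw [hg₂ n, hg₂'' n]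
  have hT₁ : ∀ (q : ℕ) (hq : q.Prime), ¬ q ∣ N' →
      (haveI : NeZero q := ⟨hq.ne_zero⟩; heckeT (Gamma0 N') 2 q g₁) = ((W₁.LFunction q : ℤ) : ℂ) • g₁ :=
    fun q hq hqN ↦ by rw [hgT₁ q hq (fun hmem ↦ hqN (hSSN' q hmem)), hf₁.2 q]
  have hT₂ : ∀ (q : ℕ) (hq : q.Prime), ¬ q ∣ N' →
      (haveI : NeZero q := ⟨hq.ne_zero⟩; heckeT (Gamma0 N') 2 q g₂) = ((W₂.LFunction q : ℤ) : ℂ) • g₂ :=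
    fun q hq hqN ↦ by rw [hgT₂ q hq (fun hmem ↦ hqN (hSSN' q hmem)), hf₂.2 q]
  have hU₁ : ∀ (q : ℕ) (hq : q.Prime), q ∣ N' → (haveI : NeZero q := ⟨hq.ne_zero⟩; heckeT (Gamma0 N') 2 q g₁) = 0 :=
    fun q hq hqN ↦ hgU₁ q hq (hLS q hq hqN)
  have hU₂ : ∀ (q : ℕ) (hq : q.Prime), q ∣ N' → (haveI : NeZero q := ⟨hq.ne_zero⟩; heckeT (Gamma0 N') 2 q g₂) = 0 :=
    fun q hq hqN ↦ hgU₂ q hq (hLS q hq hqN)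
  -- the same `hgᵢ` with the classical decidability instance (syntactic shape of `…OrdPlusLineOdd` / `…OrdPlusLineCusp`)
  have hg₁' : ∀ n : ℕ, cuspCoeff g₁ n =
      @ite ℂ (∃ ℓ ∈ SS, ℓ ∣ n) (Classical.propDecidable _) 0 (cuspCoeff f₁ n) :=
    fun n ↦ by rw [hg₁ n]; split_ifs <;> rfl
  have hg₂' : ∀ n : ℕ, cuspCoeff g₂ n =
      @ite ℂ (∃ ℓ ∈ SS, ℓ ∣ n) (Classical.propDecidable _) 0 (cuspCoeff f₂ n) :=
    fun n ↦ by rw [hg₂ n]; split_ifs <;> rfl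
  -- §4 `a_q(W₁) ≡ a_q(W₂) (mod 2)` at every prime `q ∤ N'`
  have hcong : ∀ (q : ℕ), q.Prime → ¬ q ∣ N' → Even (W₂.LFunction q - W₁.LFunction q) := by
    intro q hq hqN
    by_cases hq2 : q = 2
    · subst hq2
      have ho₁ : Odd (W₁.frobeniusTrace 2) :=
        Int.not_even_iff_odd.mp fun h ↦ hord₁.2 (by exact_mod_cast even_iff_two_dvd.mp h)
      have ho₂ : Odd (W₂.frobeniusTrace 2) :=
        Int.not_even_iff_odd.mp fun h ↦ hord₂.2 (by exact_mod_cast even_iff_two_dvd.mp h)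
      rw [LFunction_apply_prime_eq_frobeniusTrace W₁ 2 hord₁.1, LFunction_apply_prime_eq_frobeniusTrace W₂ 2 hord₂.1]
      exact Odd.sub_odd ho₂ ho₁
    · exact even_LFunction_sub_of_sharedCubicField W₂ W₁ hF ht₂ ht₁ he₂ he₁ hq hq2
        (fun h ↦ hqN (h.trans hN₂N')) (fun h ↦ hqN (h.trans hN₁N'))
  -- §5 the integral functionals `n₁, n₂` (plus) and `m₁` (minus) on `Λ`, an odd value of `n₁`, and THE SELECTION (sign-free)
  have hintΛ₁ := exists_int_depleted_periodFunctional W₁ hf₁ SS hSSp N' hNL₁ g₁ hg₁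
  have hintΛ₂ := exists_int_depleted_periodFunctional W₂ hf₂ SS hSSp N' hNL₂ g₂ hg₂
  have hintΛ₃ := exists_int_depleted_minusFunctional W₁ hf₁ SS hSSp N' hNL₁ g₁ hg₁
  obtain ⟨γ₁, w₁, hw₁, hw₁odd⟩ :=
    exists_odd_depleted_periodFunctional W₁ hord₁ ht₁ hf₁ l hlnd hl2 N' hN'odd hNL₁ g₁ hg₁' hT₁ hG₁
  obtain ⟨γ₂, w₂, hw₂, hw₂odd⟩ :=
    exists_odd_depleted_periodFunctional W₂ hord₂ ht₂ hf₂ l hlnd hl2 N' hN'odd hNL₂ g₂ hg₂' hT₂ hG₂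
  have hΛ : ∀ {x : Module.Dual ℂ (CuspForm (Gamma0 N') 2)}, x ∈ periodHomology N' → ∀ {z₁ z₂ : ℤ},
      (2 * ((D : ℕ) : ℝ) / plusPeriod f₁) * (x g₁).re = z₁ → (2 * ((D : ℕ) : ℝ) / plusPeriod f₂) * (x g₂).re = z₂ →
      (Even z₁ ↔ Even z₂) :=
    fun hx _ _ hz₁ hz₂ ↦ periodFunctionals_congr_mod_two_of_real_antiInvariant_witness W₁ hSD hBz ht₁ hΔ₂ hf₁ SS hSSp N' hN'odd hNL₁ hLS
      hgood₁ g₁ g₂ hgr₁ hgr₂ (fun q ↦ W₂.LFunction q) hT₁ hT₂ hcong hU₁ hU₂ _ _ _ hintΛ₁ hintΛ₂ hintΛ₃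
      ⟨_, periodFunctional_mem_periodHomology N' γ₁, w₁, hw₁, hw₁odd⟩ ⟨_, periodFunctional_mem_periodHomology N' γ₂, w₂, hw₂, hw₂odd⟩
      hII hx hz₁ hz₂
  -- §6 the cusp `0`: `‖Ψ₁(0) − Ψ₂(0)‖₂ ≤ 1` by `T_q`-transport at a good prime `q ∤ N'` with `a_q(W₁) − q − 1` odd
  obtain ⟨q, hq, hqS, -, hgoodq, hqodd⟩ :=
    exists_prime_notMem_not_dvd_frobeniusTrace_sub W₁ 2 hirr₁ (N'.primeFactors : Set ℕ) (Finset.finite_toSet _)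
  have hqN' : ¬ q ∣ N' := fun h ↦ hqS (Finset.mem_coe.mpr (Nat.mem_primeFactors.mpr ⟨hq.out, h, NeZero.ne N'⟩))
  obtain ⟨γs, hγs⟩ := exists_heckeT_transport_zero (N' := N') hq.out hqN'
  obtain ⟨u₁, hu₁⟩ : ∃ u : ℤ, u = W₁.LFunction q - q - 1 := ⟨_, rfl⟩
  obtain ⟨u₂, hu₂⟩ : ∃ u : ℤ, u = W₂.LFunction q - q - 1 := ⟨_, rfl⟩
  have hrel₁ : (u₁ : ℂ) * modularSymbol g₁ 0 = ∑ j, cuspSymbol g₁ (γs j) := by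
    rw [← hγs g₁ _ (hT₁ q hq.out hqN'), hu₁]; push_cast; ring
  have hrel₂ : (u₂ : ℂ) * modularSymbol g₂ 0 = ∑ j, cuspSymbol g₂ (γs j) := by
    rw [← hγs g₂ _ (hT₂ q hq.out hqN'), hu₂]; push_cast; ring
  choose zs₁ hzs₁ using fun j : Fin q ↦ hintΛ₁ _ (periodFunctional_mem_periodHomology N' (γs j))
  choose zs₂ hzs₂ using fun j : Fin q ↦ hintΛ₂ _ (periodFunctional_mem_periodHomology N' (γs j))
  have hsum₁ := intCast_mul_depleted_zero_eq_sum W₁ hf₁ l hlnd N' hNL₁ g₁ hg₁' hrel₁ hzs₁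
  have hsum₂ := intCast_mul_depleted_zero_eq_sum W₂ hf₂ l hlnd N' hNL₂ g₂ hg₂' hrel₂ hzs₂
  have hu₁odd : Odd u₁ := by
    rw [hu₁, LFunction_apply_prime_eq_frobeniusTrace W₁ q hgoodq, ← Int.not_even_iff_odd, even_iff_two_dvd,
      show W₁.frobeniusTrace q - q - 1 = W₁.frobeniusTrace q - (q + 1) by ring]
    exact hqodd
  have hu : Even (u₁ - u₂) := by
    rw [hu₁, hu₂, show W₁.LFunction q - q - 1 - (W₂.LFunction q - q - 1) = -(W₂.LFunction q - W₁.LFunction q) by ring]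
    exact (hcong q hq.out hqN').neg
  have hZ : Even (∑ j, zs₁ j - ∑ j, zs₂ j) := by
    rw [← Finset.sum_sub_distrib]
    exact Finset.even_sum (s := Finset.univ) (f := fun j ↦ zs₁ j - zs₂ j) fun j _ ↦
      Int.even_sub.mpr (hΛ (periodFunctional_mem_periodHomology N' (γs j)) (hzs₁ j) (hzs₂ j))
  -- `‖Ψ₂(0)‖₂ ≤ 2`
  have hΨ₂0 : ‖((eulerDepleteTableList W₂ l (ratPlusSymbol f₂) 0 : ℚ) : ℚ_[2])‖ ≤ 2 := by
    have hreal₂ : ∀ n, (cuspCoeff f₂ n).im = 0 := cuspCoeff_im_eq_zero_of_coeffField_eq_bot hf₂.coeffField_eq_bot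
    obtain ⟨n₂, h2n₂, h02⟩ := exists_intCast_mul_modularSymbol_zero_mem (p := 2) not_irreducible_of_frobeniusTrace_congr_holds hf₂
      (irr_two_of_forall_not_hasRationalTwoTorsionX W₂ ht₂)
    have hsym : ∀ m k : ℕ, ‖((ratPlusSymbol f₂ ((m : ℚ) / ((2 : ℕ) : ℚ) ^ k) : ℚ) : ℚ_[2])‖ ≤ 2 := fun m k ↦
      norm_ratPlusSymbol_two_le_two f₂ hreal₂ h2n₂ h02 (coprime_den_div_prime_pow h2N₂ m k)
    have h := norm_eulerDepleteTableList_le W₂ (p := 2) l hl2 (φ := ratPlusSymbol f₂) zero_le_two hsym 0 0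
    rwa [Nat.cast_zero, zero_div] at h
  have h0 : ‖((eulerDepleteTableList W₁ l (ratPlusSymbol f₁) 0 - eulerDepleteTableList W₂ l (ratPlusSymbol f₂) 0 : ℚ) : ℚ_[2])‖ ≤ 1 :=
    norm_sub_le_one_of_cusp_transport hDnorm hu₁odd hu hZ hsum₁ hsum₂ hΨ₂0
  -- §7 `‖Ψ₁(m/2ᵏ) − Ψ₂(m/2ᵏ)‖₂ ≤ 1`: `m/2ᵏ = γ·0`, `nᵢ(γ) = 2D(Ψᵢ(m/2ᵏ) − Ψᵢ(0))`, `n₁(γ) ≡ n₂(γ)`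
  have hpar : ∀ m k : ℕ,
      ‖((eulerDepleteTableList W₁ l (ratPlusSymbol f₁) ((m : ℚ) / (2 : ℚ) ^ k) -
          eulerDepleteTableList W₂ l (ratPlusSymbol f₂) ((m : ℚ) / (2 : ℚ) ^ k) : ℚ) : ℚ_[2])‖ ≤ 1 := by
    intro m k
    obtain ⟨γ, hγ⟩ := exists_gamma0_modularSymbol_eq_of_coprime_den (N' := N') (coprime_den_twoPow hN'odd m k)
    obtain ⟨z₁, hz₁⟩ := hintΛ₁ _ (periodFunctional_mem_periodHomology N' γ)
    obtain ⟨z₂, hz₂⟩ := hintΛ₂ _ (periodFunctional_mem_periodHomology N' γ)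
    exact norm_sub_le_one_of_even_sub hDnorm
      (Int.even_sub.mpr (hΛ (periodFunctional_mem_periodHomology N' γ) hz₁ hz₂))
      (intCast_eq_depleted_sub W₁ hf₁ l hlnd N' hNL₁ g₁ hg₁' hγ hz₁)
      (intCast_eq_depleted_sub W₂ hf₂ l hlnd N' hNL₂ g₂ hg₂' hγ hz₂) h0
  -- §8 raw reduction identity ⇒ `λ`-law over the odd primes of `M = q₀N₁N₂` ⇒ over the odd primes of `N₁N₂`
  have h := red_depleted_eq_of_sigmaSymbolParity W₁ W₂ hord₁ hord₂ ht₁ ht₂ hf₁ hf₂ l hl2 hpar hG₁ hG₂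
  rw [hl, Finset.prod_map_toList, Finset.prod_map_toList, ← eulerFactorProductInv_eq_prod, ← eulerFactorProductInv_eq_prod] at h
  have hP₁ : HasUnitContent (eulerFactorProductInv W₁ 2 S) := (order_map_toZMod_eulerFactorProductInv_two W₁ S hS2).1
  obtain ⟨hred₂, hpf⟩ := muTransfer_and_pfree_eq_of_raw_eq hred₁ hP₁ h
  exact lamLaw_of_lamLaw_auxPrime W₁ W₂ (mul_ne_zero hN₁0 hN₂0) hq₀ hq₀2 hq₀N
    (lambdaCorrectionAtTwo_eq_of_sharedCubicField W₁ W₂ hF ht₁ ht₂ he₁ he₂ hq₀ hq₀2 hq₀N₁ hq₀N₂)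
    (lam_add_sum_lambdaCorrectionAtTwo_eq_of_depleted_symbol_eq W₁ W₂ hred₁ hred₂ hS2 himg hpf)

/-- **Matrix form of the single witness: `γ = (a b; c a) ∈ Γ₀(N')` with `(2D/Ω⁻(f₁))·im{∞, a/c}_{g₁}` odd ⇒ the `λ`-law** (corollary of
`lamLaw_of_not_padicSquare_of_antiInvariant_witness` and `…OrdPlusLineWitnessClasses.periodFunctional_iotaConj_eq_neg_of_apply_eq`).
[cite: GreenbergVatsal2000, Thm. (1.4) and §3 Remark 3.4] [cite: Buzzard2000LevelLoweringModTwo, Prop. 2.4] [cite: CremonaAlgorithms1997, §2.1 and §2.5] -/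
theorem lamLaw_of_not_padicSquare_of_matrix_witness
    (hSD : heckeSelfDual_torsionBy_J0) (hBz : buzzard2000_multiplicityOne_gamma0)
    (W₁ : WeierstrassCurve ℚ) [W₁.IsElliptic] [W₁.IsGloballyMinimal]
    (W₂ : WeierstrassCurve ℚ) [W₂.IsElliptic] [W₂.IsGloballyMinimal]
    (hord₁ : IsOrdinaryAt W₁ 2) (hord₂ : IsOrdinaryAt W₂ 2)
    (ht₁ : ∀ x : ℚ, ¬ HasRationalTwoTorsionX W₁ x) (ht₂ : ∀ x : ℚ, ¬ HasRationalTwoTorsionX W₂ x)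
    (hΔ₂ : ∀ s : ℚ_[2], s ^ 2 ≠ (W₁.Δ : ℚ_[2]))
    {F : Type} [Field F] [NumberField F] (hF : finrank ℚ F = 3)
    {e₁ e₂ : F} (he₁ : aeval e₁ (twoDivisionUCubic W₁) = 0) (he₂ : aeval e₂ (twoDivisionUCubic W₂) = 0)
    [NeZero (W₁.conductorNorm ℤ)] [NeZero (W₂.conductorNorm ℤ)]
    {f₁ : CuspForm (Gamma0 (W₁.conductorNorm ℤ)) 2} (hf₁ : IsNewformOf W₁ f₁)
    {f₂ : CuspForm (Gamma0 (W₂.conductorNorm ℤ)) 2} (hf₂ : IsNewformOf W₂ f₂)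
    {G₁ G₂ : IwasawaAlgebra 2} (hG₁ : IsEvenBranchLiftAtTwo W₁ f₁ G₁) (hG₂ : IsEvenBranchLiftAtTwo W₂ f₂ G₂)
    {q₀ : ℕ} (hq₀ : q₀.Prime) (hq₀2 : q₀ ≠ 2) (hq₀N : ¬ q₀ ∣ W₁.conductorNorm ℤ * W₂.conductorNorm ℤ)
    (SS : Finset ℕ) (hSS : SS = (q₀ * (W₁.conductorNorm ℤ * W₂.conductorNorm ℤ)).primeFactors.erase 2)
    (N' : ℕ) [NeZero N'] (hN' : N' = q₀ * (W₁.conductorNorm ℤ * W₂.conductorNorm ℤ) * ∏ ℓ ∈ SS, ℓ ^ 2)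
    (g₁ g₂ : CuspForm (Gamma0 N') 2)
    (hg₁ : ∀ n : ℕ, cuspCoeff g₁ n = if ∃ ℓ ∈ SS, ℓ ∣ n then 0 else cuspCoeff f₁ n)
    (hg₂ : ∀ n : ℕ, cuspCoeff g₂ n = if ∃ ℓ ∈ SS, ℓ ∣ n then 0 else cuspCoeff f₂ n)
    (hII : ∃ γ : Gamma0 N', (γ : SL(2, ℤ)) 0 0 = (γ : SL(2, ℤ)) 1 1 ∧
      ∃ w : ℤ, (2 * ((∏ ℓ ∈ SS, ℓ ^ 2 : ℕ) : ℝ) / minusPeriod f₁) * (cuspSymbol g₁ γ).im = w ∧ Odd w) :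
    lam G₁ + ∑ ℓ ∈ (W₁.conductorNorm ℤ * W₂.conductorNorm ℤ).primeFactors.erase 2, lambdaCorrectionAtTwo W₁ ℓ =
      lam G₂ + ∑ ℓ ∈ (W₁.conductorNorm ℤ * W₂.conductorNorm ℤ).primeFactors.erase 2, lambdaCorrectionAtTwo W₂ ℓ := by
  obtain ⟨γ, hγ, w, hw, hwodd⟩ := hII
  exact lamLaw_of_not_padicSquare_of_antiInvariant_witness hSD hBz W₁ W₂ hord₁ hord₂ ht₁ ht₂ hΔ₂ hF he₁ he₂ hf₁ hf₂ hG₁ hG₂ hq₀ hq₀2 hq₀N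
    SS hSS N' hN' g₁ g₂ hg₁ hg₂ ⟨γ, periodFunctional_iotaConj_eq_neg_of_apply_eq γ hγ, w, hw, hwodd⟩

end Summit.BirchSwinnertonDyer.BirchSwinnertonDyer.Theorems.AlignedTransportAtTwoOrdPlusLineWitnessMinusLaw

end
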